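import Literature.NumberTheory.PAdicHodge.FontainePstInductionSchemata
import Literature.NumberTheory.PAdicHodge.DeRhamRestrictFieldDescentHolds
import Literature.NumberTheory.PAdicHodge.DeRhamBaseChangeProofs
import Literature.NumberTheory.GaloisRepresentations.PstWeilDeligneHeredity
import Literature.NumberTheory.GaloisRepresentations.InducedRestrictSplit
import Literature.NumberTheory.GaloisRepresentations.AbsGaloisOuterConj
import HarnessLib

/-!
# Induction preserves de Rham-ness for the pinned Fontaine data — discharge of
# `IsDeRhamFramedInduceSchema` (Patrikis 2019, Lemma 7.2.1; Fontaine, Exposé III, Prop. 1.5.2)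

Topic `NumberTheory/PAdicHodge`.  PROOF FILE (theorems only: no definition, no named fact, no
instance; D-0026).  It proves

* `Literature.NumberTheory.PAdicHodge.IsDeRhamFramedInduceSchema_holds` — the named fact
  `IsDeRhamFramedInduceSchema` of `FontainePstInductionSchemata`: for number fields `K ⊆ E`,
  `[E : K] = d`, and a framed `W : Γ_E → GL_n(ℚ̄_ℓ)` de Rham at every place `w ∣ ℓ` of `E` (pinned
  datum `fontainePstAdicCompletion w ℓ hw`), the induced representation `Ind_{Γ_E}^{Γ_K} W`
  (`FramedGaloisRep.induce`) is de Rham at every place `v ∣ ℓ` of `K`.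

## The argument (Galois closure instead of Mackey's formula)

The printed proof (Patrikis, Lemma 7.2.1: `D_dR(Ind W)` is `D_dR(W)` with the `L`-structure
forgotten; globalised by Mackey's decomposition of `(Ind W)|_{Γ_{K_v}}`) computes `D_dR` of an
induced representation.  The tree has no functorial `D_dR`; it has instead the two halves of
Brinon–Conrad's Prop. 6.3.8, both PROVED for the pinned data — de Rham-ness is insensitive to a
finite extension of the base, downwards (`DeRhamRestrictFieldDescent_holds`: if `ρ|_{Γ_L}` is de Rham
at every `u ∣ ℓ` of `L` then `ρ` is de Rham at every `v ∣ ℓ` of `K`) and upwards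
(`isDeRhamFramed_toLocal_restrictField`, from `DeRhamBaseChange_holds`) — and Fontaine's Prop. 1.5.2
(direct sums of `B`-admissible representations are admissible: `PeriodRingData.isAdmissible_pi_iff`).
With these the statement follows from elementary Galois theory, WITHOUT Mackey's double cosets:

1. (§1, Fontaine Prop. 1.5.2 for framed block-diagonal representations.)  If
   `T : Γ_F → GL_{dn}(ℚ̄_ℓ)` is block diagonal, `T(g) = e·diag(B₁(g), …, B_d(g))·e⁻¹` along
   `e : Fin d × Fin n ≃ Fin (dn)`, and every block `Bᵢ` is de Rham for a datum `(alg, 𝔅)`, then `T`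
   is de Rham: choose models of the `Bᵢ` over finite `Eᵢ/ℚ_ℓ` (`HasQlModel`), conjugate them into
   honest extensions of scalars (`exists_conj_baseChange_eq_of_hasQlModel`), pass to the compositum
   `E'' = ⨆ Eᵢ` (`isAdmissible_restrictScalars_baseChange_iff`), corestrict `T` to `E''`
   (`FramedRep.exists_baseChange_eq`) and apply `isAdmissible_pi_iff` along the `ℚ_ℓ[Γ]`-isomorphism
   `⊕ᵢ E''ⁿ ≅ E''^{dn}` (`PeriodRingData.isAdmissible_restrictScalars_of_blockDiagonal`,
   `FramedRep.IsDeRhamWith.of_blockDiagonal`, `PstWeilDeligneData.isDeRhamFramed_of_blockDiagonal`).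
2. (§2, the blocks of `(Ind_E^K W)|_{Γ_L}` for the Galois closure `L`.)  Let `L/K` be Galois
   containing all conjugates of `E`; write `ε : E → K̄`, `λ : L → K̄` for the embeddings attached to
   the tree's restriction maps (`absEmbedding`), `res(Γ_E) = Fix ε(E)`, `res(Γ_L) = Fix λ(L)`, and
   `rᵢ` for the transversal of `Γ_K / res(Γ_E)` used by `induce` (`absGaloisCosetRep`).  Since
   `rᵢ ε(E) ⊆ λ(L)`, every `rᵢ⁻¹ res(σ) rᵢ`, `σ ∈ Γ_L`, fixes `ε(E)`, so `(Ind W)(res σ)` is block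
   diagonal ON THE NOSE (`induce_apply_coe_of_forall_conj_mem`, the totally split case of Mackey),
   with `i`-th block `W(res_E⁻¹(rᵢ⁻¹ res(σ) rᵢ))`.  The map `σ ↦ res_E⁻¹(rᵢ⁻¹ res(σ) rᵢ)` is a
   restriction map `Γ_L → Γ_E` for the embedding `eᵢ = λ⁻¹ ∘ rᵢ ∘ ε : E → L` (compatible with the
   isomorphism `ι_L ∘ rᵢ ∘ ι_E⁻¹ : Ē ≅ L̄` of algebraic closures), hence (restriction maps being well
   defined up to conjugacy, `absGaloisRestrict_isConj_of_algHom_holds`) it is `t · res_{L/E,eᵢ}(σ) · t⁻¹`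
   for one `t ∈ Γ_E`: the `i`-th block is the change of frame `W(t) (W|_{Γ_L, eᵢ}) W(t)⁻¹` of the
   restriction of `W` to `Γ_L` along `eᵢ` (`exists_ringHom_absEmbedding_eq`,
   `exists_conj_absGaloisRestrict_eq_of_absEmbedding_eq`, `exists_block_isDeRhamFramed`).  By
   `isDeRhamFramed_toLocal_restrictField` (upward half of Brinon–Conrad 6.3.8, any embedding `E → L`)
   and frame invariance (`isDeRhamFramed_conj_iff`) every block is de Rham at every `u ∣ ℓ` of `L`.
3. (§3.)  Hence `(Ind W)|_{Γ_L}` is de Rham at every `u ∣ ℓ` (§1 at `Γ_{L_u}`), and by the downward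
   half (`DeRhamRestrictFieldDescent_holds`) `Ind W` is de Rham at every `v ∣ ℓ` of `K`.  The Galois
   closure is Mathlib's `normalClosure K E K̄` (a number field, `IsGalois K _`).

## References

* [Patrikis2019] S. Patrikis, *Variations on a theorem of Tate*, Mem. Amer. Math. Soc. 258 (2019),
  no. 1238, §7.2 Lemma 7.2.1 (arXiv:1207.6724 p. 38) and p. 64.
* [BrinonConrad2009] O. Brinon, B. Conrad, *CMI Summer School notes on p-adic Hodge theory* (2009),
  Thm. 5.2.1 (exactness and sums), Prop. 6.3.8 (finite base change).
* [FontaineAsterisque223III] J.-M. Fontaine, *Représentations p-adiques semi-stables*, Astérisque 223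
  (1994), Exposé III, Prop. 1.5.2 (sums of `B`-admissible representations).
* [SerreLinearRepresentations1977] J.-P. Serre, *Linear representations of finite groups*, GTM 42,
  §7.3 Prop. 22 (restriction of an induced representation).
* [MilneFT2022] J. S. Milne, *Fields and Galois Theory* (v4.60), Ch. 7 (the absolute Galois group is
  defined up to an inner automorphism).
-/

noncomputable section

open scoped NumberField MatrixGroups Matrix TensorProduct
open NumberField IsDedekindDomain Field
open Literature.NumberTheory.Automorphic Literature.NumberTheory.PAdicHodge

namespace Literature.NumberTheory.GaloisRepresentations

/-! ### §1 Block-diagonal framed representations with de Rham blocks are de Rham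
(Fontaine, Exposé III, Prop. 1.5.2: sums) -/

namespace PeriodRingData

section BlockDiagonal

-- Mathlib's own global value (nested instance problems on `𝔅.B ⊗[P] M`, see `PAdicHodgeProofs`).
set_option maxSynthPendingDepth 3

universe u v' w

variable {p : ℕ} [Fact p.Prime] {Γ : Type u} [Group Γ] [TopologicalSpace Γ]
  {E₁ : Type v'} [Field E₁] [Algebra ℚ_[p] E₁] (𝔅 : PeriodRingData.{u, 0, v', w} Γ ℚ_[p] E₁)

omit [Fact p.Prime] in
/-- The entries of the block matrix `diag(S₁, …, S_d)` (`Matrix.comp` of a diagonal matrix of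
blocks). [folklore] -/
private theorem comp_diagonal_apply_mk {R : Type*} [Zero R] {d n : ℕ} (S : Fin d → Matrix (Fin n) (Fin n) R)
    (i j : Fin d) (k l : Fin n) :
    Matrix.comp (Fin d) (Fin d) (Fin n) (Fin n) R (Matrix.diagonal S) (i, k) (j, l) =
      if i = j then S i k l else 0 := by
  rw [Matrix.comp_apply, Matrix.diagonal_apply]
  split_ifs with h
  · rfl
  · rfl

/-- **Block-diagonal representations with admissible blocks are admissible** (framed form of
Fontaine's Prop. 1.5.2 for direct sums).  If `T : Γ →ₜ* GL_N(E')` (`E'/ℚ_p` finite) is block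
diagonal along `e : Fin d × Fin n ≃ Fin N`, `T(g) = e·diag(S₁(g), …, S_d(g))·e⁻¹` with framed
`Sᵢ : Γ →ₜ* GL_n(E')`, and the `ℚ_p`-restriction of every `Sᵢ` is `B`-admissible, then so is that of
`T`: `w ↦ (j ↦ w (e⁻¹ j))` is an isomorphism of `ℚ_p[Γ]`-modules `⊕ᵢ E'ⁿ ≅ E'^N`, and finite direct
sums are admissible iff all summands are (`isAdmissible_pi_iff`).
Ref: Fontaine, Astérisque 223 (1994), Exposé III, Prop. 1.5.2. [cite: FontaineAsterisque223III, Prop. 1.5.2] -/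
theorem isAdmissible_restrictScalars_of_blockDiagonal
    {E' : IntermediateField ℚ_[p] (PadicAlgCl p)} [FiniteDimensional ℚ_[p] E'] {d n N : ℕ}
    (e : Fin d × Fin n ≃ Fin N) (T : FramedRep Γ E' N) (S : Fin d → FramedRep Γ E' n)
    (hT : ∀ g, ((T g : GL (Fin N) E') : Matrix (Fin N) (Fin N) E') =
      Matrix.reindex e e (Matrix.comp (Fin d) (Fin d) (Fin n) (Fin n) E'
        (Matrix.diagonal fun i => ((S i g : GL (Fin n) E') : Matrix (Fin n) (Fin n) E'))))
    (hS : ∀ i, 𝔅.IsAdmissible (FramedRep.restrictScalars ℚ_[p] (S i))) :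
    𝔅.IsAdmissible (FramedRep.restrictScalars ℚ_[p] T) := by
  classical
  obtain ⟨ρπ, hρπ⟩ :=
    ContinuousRep.exists_pi (fun i : Fin d => FramedRep.restrictScalars ℚ_[p] (S i))
  -- the `ℚ_p`-linear isomorphism `⊕ᵢ E'ⁿ ≃ E'^N`, `w ↦ (j ↦ w (e⁻¹ j).1 (e⁻¹ j).2)`
  let Φ : (Fin d → Fin n → E') ≃ₗ[ℚ_[p]] (Fin N → E') :=
    { toFun := fun w j => w (e.symm j).1 (e.symm j).2
      invFun := fun v i k => v (e (i, k))
      map_add' := fun _ _ => rfl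
      map_smul' := fun _ _ => rfl
      left_inv := fun w => by
        funext i k
        simp only [Equiv.symm_apply_apply]
      right_inv := fun v => by
        funext j
        simp only [Prod.mk.eta, Equiv.apply_symm_apply] }
  have hΦ : ∀ (σ : Γ) (w : Fin d → Fin n → E'),
      Φ (ρπ σ w) = FramedRep.restrictScalars ℚ_[p] T σ (Φ w) := by
    intro σ w
    funext j
    change ρπ σ w (e.symm j).1 (e.symm j).2 = _
    rw [hρπ, FramedRep.restrictScalars_apply_apply, FramedRep.restrictScalars_apply_apply, hT,
      Matrix.mulVec, Matrix.mulVec, dotProduct, dotProduct, ← e.sum_comp]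
    change _ = ∑ x : Fin d × Fin n, (Matrix.reindex e e _) j (e x) * w (e.symm (e x)).1 (e.symm (e x)).2
    have hsplit : ∀ x : Fin d × Fin n, (Matrix.reindex e e (Matrix.comp (Fin d) (Fin d) (Fin n) (Fin n) E'
        (Matrix.diagonal fun i => ((S i σ : GL (Fin n) E') : Matrix (Fin n) (Fin n) E')))) j (e x) =
        if (e.symm j).1 = x.1 then ((S (e.symm j).1 σ : GL (Fin n) E') : Matrix (Fin n) (Fin n) E')
          (e.symm j).2 x.2 else 0 := fun x => by
      rw [Matrix.reindex_apply, Matrix.submatrix_apply, Equiv.symm_apply_apply]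
      exact comp_diagonal_apply_mk _ _ _ _ _
    simp only [hsplit, Fintype.sum_prod_type, Equiv.symm_apply_apply]
    rw [Finset.sum_eq_single (e.symm j).1]
    · simp
    · intro i _ hi
      simp only [if_neg (Ne.symm hi), zero_mul, Finset.sum_const_zero]
    · intro h
      exact absurd (Finset.mem_univ _) h
  rw [← 𝔅.isAdmissible_iff_of_equiv ρπ _ Φ hΦ,
    𝔅.isAdmissible_pi_iff ρπ (fun i : Fin d => FramedRep.restrictScalars ℚ_[p] (S i)) hρπ]
  exact hS

end BlockDiagonal

end PeriodRingData

section DeRhamBlockDiagonal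

variable {F : Type} [Field F] {ℓ : ℕ} [Fact ℓ.Prime]

-- Mathlib's own global value (nested instance problems on `𝔅.B ⊗[P] M`, see `PAdicHodgeProofs`).
set_option maxSynthPendingDepth 3 in
/-- **A block-diagonal framed representation with de Rham blocks is de Rham** (Fontaine, Exposé III,
Prop. 1.5.2: finite direct sums of `B`-admissible representations are `B`-admissible).  For a
`ℚ_ℓ`-algebra structure `alg` on `F` and a period-ring datum `𝔅` for `Γ_F`: if
`T : Γ_F →ₜ* GL_N(ℚ̄_ℓ)` is block diagonal along `e : Fin d × Fin n ≃ Fin N`,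
`T(g) = e·diag(B₁(g), …, B_d(g))·e⁻¹` with framed `Bᵢ : Γ_F →ₜ* GL_n(ℚ̄_ℓ)` all de Rham for
`(alg, 𝔅)` (accepted `FramedRep.IsDeRhamWith`), then `T` is de Rham for `(alg, 𝔅)` — with model
field the compositum `E''` of the model fields of the blocks (after `exists_conj_baseChange_eq_of_hasQlModel`),
model the corestriction of `T` to `E''` (`FramedRep.exists_baseChange_eq`) and admissibility
`PeriodRingData.isAdmissible_restrictScalars_of_blockDiagonal`.
Ref: Fontaine, Astérisque 223 (1994), Exposé III, Prop. 1.5.2; Brinon–Conrad 2009, Thm. 5.2.1.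
[cite: FontaineAsterisque223III, Prop. 1.5.2] -/
theorem FramedRep.IsDeRhamWith.of_blockDiagonal (alg : Algebra ℚ_[ℓ] F)
    (𝔅 : PeriodRingData.{0, 0, 0, 0} (absoluteGaloisGroup F) ℚ_[ℓ] F) {d n N : ℕ}
    (e : Fin d × Fin n ≃ Fin N) {T : FramedRep (absoluteGaloisGroup F) (PadicAlgCl ℓ) N}
    {B : Fin d → FramedRep (absoluteGaloisGroup F) (PadicAlgCl ℓ) n}
    (hT : ∀ g, ((T g : GL (Fin N) (PadicAlgCl ℓ)) : Matrix (Fin N) (Fin N) (PadicAlgCl ℓ)) =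
      Matrix.reindex e e (Matrix.comp (Fin d) (Fin d) (Fin n) (Fin n) (PadicAlgCl ℓ)
        (Matrix.diagonal fun i =>
          ((B i g : GL (Fin n) (PadicAlgCl ℓ)) : Matrix (Fin n) (Fin n) (PadicAlgCl ℓ)))))
    (hB : ∀ i, (B i).IsDeRhamWith alg 𝔅) : T.IsDeRhamWith alg 𝔅 := by
  letI := alg
  classical
  -- models of the blocks over finite extensions of `ℚ_ℓ`, conjugated into extensions of scalars
  have hmod : ∀ i, ∃ (E' : IntermediateField ℚ_[ℓ] (PadicAlgCl ℓ)) (_ : FiniteDimensional ℚ_[ℓ] E')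
      (S : FramedRep (absoluteGaloisGroup F) E' n),
      S.baseChange (algebraMap E' (PadicAlgCl ℓ)) continuous_subtype_val = B i ∧
        𝔅.IsAdmissible (FramedRep.restrictScalars ℚ_[ℓ] S) := by
    intro i
    obtain ⟨E, hE, rE, hmodel, hadm⟩ := hB i
    haveI := hE
    obtain ⟨E', hEE', hE', Q, hTQ⟩ := exists_conj_baseChange_eq_of_hasQlModel hmodel
    haveI := hE'
    refine ⟨E', hE', _, hTQ, ?_⟩
    rw [𝔅.isAdmissible_restrictScalars_conj_iff, 𝔅.isAdmissible_restrictScalars_baseChange_iff]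
    exact hadm
  choose E' hE' S hSB hSadm using hmod
  -- the compositum of the model fields
  haveI : ∀ i, FiniteDimensional ℚ_[ℓ] (E' i) := hE'
  let E'' : IntermediateField ℚ_[ℓ] (PadicAlgCl ℓ) := ⨆ i, E' i
  haveI : FiniteDimensional ℚ_[ℓ] E'' := IntermediateField.finiteDimensional_iSup_of_finite
  have hle : ∀ i, E' i ≤ E'' := fun i => le_iSup E' i
  let S' : Fin d → FramedRep (absoluteGaloisGroup F) E'' n := fun i =>
    (S i).baseChange (IntermediateField.inclusion (hle i)).toRingHom
      (continuous_intermediateField_inclusion (hle i))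
  have hS'B : ∀ i, (S' i).baseChange (algebraMap E'' (PadicAlgCl ℓ)) continuous_subtype_val = B i :=
    fun i => by
    rw [← hSB i]
    exact ContinuousMonoidHom.ext fun g => Units.ext (Matrix.ext fun a b => rfl)
  have hS'adm : ∀ i, 𝔅.IsAdmissible (FramedRep.restrictScalars ℚ_[ℓ] (S' i)) := fun i => by
    rw [𝔅.isAdmissible_restrictScalars_baseChange_iff]
    exact hSadm i
  -- `T` has all its entries in `E''`
  have hTmem : ∀ g a b, ((T g : GL (Fin N) (PadicAlgCl ℓ)) :
      Matrix (Fin N) (Fin N) (PadicAlgCl ℓ)) a b ∈ E'' := by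
    intro g a b
    rw [hT g, Matrix.reindex_apply, Matrix.submatrix_apply, Matrix.comp_apply, Matrix.diagonal_apply]
    split_ifs with h
    · rw [← hS'B, FramedRep.coe_baseChange_apply, Matrix.map_apply]
      exact SetLike.coe_mem _
    · rw [Matrix.zero_apply]
      exact zero_mem _
  obtain ⟨TE, hTE⟩ := FramedRep.exists_baseChange_eq T E'' fun g a b =>
    ⟨hTmem g a b, by rw [← map_inv]; exact hTmem g⁻¹ a b⟩
  -- and is block diagonal over `E''` with blocks `S'ᵢ`
  have hTE' : ∀ g, ((TE g : GL (Fin N) E'') : Matrix (Fin N) (Fin N) E'') =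
      Matrix.reindex e e (Matrix.comp (Fin d) (Fin d) (Fin n) (Fin n) E''
        (Matrix.diagonal fun i => ((S' i g : GL (Fin n) E'') : Matrix (Fin n) (Fin n) E''))) := by
    intro g
    apply Matrix.map_injective (algebraMap E'' (PadicAlgCl ℓ)).injective
    change ((TE g : GL (Fin N) E'') : Matrix (Fin N) (Fin N) E'').map (algebraMap E'' (PadicAlgCl ℓ)) =
      (Matrix.reindex e e (Matrix.comp (Fin d) (Fin d) (Fin n) (Fin n) E''
        (Matrix.diagonal fun i => ((S' i g : GL (Fin n) E'') : Matrix (Fin n) (Fin n) E'')))).map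
          (algebraMap E'' (PadicAlgCl ℓ))
    rw [← FramedRep.coe_baseChange_apply (algebraMap E'' (PadicAlgCl ℓ)) continuous_subtype_val TE g,
      hTE, hT g]
    ext a b
    simp only [Matrix.map_apply, Matrix.reindex_apply, Matrix.submatrix_apply, Matrix.comp_apply,
      Matrix.diagonal_apply]
    split_ifs with h
    · rw [← hS'B, FramedRep.coe_baseChange_apply, Matrix.map_apply]
    · rw [Matrix.zero_apply, Matrix.zero_apply, map_zero]
  exact ⟨E'', inferInstance, TE, ⟨1, by rw [hTE, FramedRep.conj_one_eq]⟩,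
    𝔅.isAdmissible_restrictScalars_of_blockDiagonal e TE S' hTE' hS'adm⟩

/-- **A block-diagonal framed representation with de Rham blocks is de Rham, for a `p`-adic Hodge
datum** (accepted `PstWeilDeligneData.IsDeRhamFramed`; `FramedRep.IsDeRhamWith.of_blockDiagonal`
for `(𝔇.algebra, 𝔇.𝔅)`).  Ref: Fontaine, Astérisque 223 (1994), Exposé III, Prop. 1.5.2;
Brinon–Conrad 2009, Thm. 5.2.1. [cite: FontaineAsterisque223III, Prop. 1.5.2] -/
theorem PstWeilDeligneData.isDeRhamFramed_of_blockDiagonal [ValuativeRel F] [TopologicalSpace F]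
    [IsNonarchimedeanLocalField F] (𝔇 : PstWeilDeligneData F ℓ) {d n N : ℕ}
    (e : Fin d × Fin n ≃ Fin N) {T : FramedRep (absoluteGaloisGroup F) (PadicAlgCl ℓ) N}
    {B : Fin d → FramedRep (absoluteGaloisGroup F) (PadicAlgCl ℓ) n}
    (hT : ∀ g, ((T g : GL (Fin N) (PadicAlgCl ℓ)) : Matrix (Fin N) (Fin N) (PadicAlgCl ℓ)) =
      Matrix.reindex e e (Matrix.comp (Fin d) (Fin d) (Fin n) (Fin n) (PadicAlgCl ℓ)
        (Matrix.diagonal fun i =>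
          ((B i g : GL (Fin n) (PadicAlgCl ℓ)) : Matrix (Fin n) (Fin n) (PadicAlgCl ℓ)))))
    (hB : ∀ i, 𝔇.IsDeRhamFramed (B i)) : 𝔇.IsDeRhamFramed T :=
  FramedRep.IsDeRhamWith.of_blockDiagonal 𝔇.algebra 𝔇.𝔅 e hT hB

end DeRhamBlockDiagonal

/-! ### §2 The blocks of `(Ind_E^K W)|_{Γ_L}` for `L ⊇` all conjugates of `E`: restrictions of `W`
along the embeddings `E → L`, up to a change of frame -/

section Embeddings

variable {K E L : Type*} [Field K] [Field E] [Field L] [Algebra K E] [Algebra K L]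
  [Algebra.IsAlgebraic K E] [Algebra.IsAlgebraic K L]

/-- **The embedding `λ⁻¹ ∘ r ∘ ε : E → L`.**  For `r ∈ Γ_K` such that the conjugate `r ε(E)` of the
copy `ε(E) ⊆ K̄` of `E` (`absEmbedding K E`) lies in the copy `λ(L)` of `L` (`absEmbedding K L`),
there is a ring homomorphism `i : E → L` with `λ ∘ i = r ∘ ε`.
Ref: Milne, *Fields and Galois Theory*, Ch. 7. [folklore] -/
private theorem exists_ringHom_absEmbedding_eq (r : absoluteGaloisGroup K)
    (hr : ∀ x : E, ∃ y : L, absEmbedding K L y = r • absEmbedding K E x) :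
    ∃ i : E →+* L, ∀ x, absEmbedding K L (i x) = r • absEmbedding K E x := by
  choose f hf using hr
  have hinj : Function.Injective (absEmbedding K L) := (absEmbedding K L).toRingHom.injective
  refine ⟨{ toFun := f
            map_one' := hinj ?_
            map_mul' := fun x y => hinj ?_
            map_zero' := hinj ?_
            map_add' := fun x y => hinj ?_ }, hf⟩
  · rw [hf, map_one, smul_one, map_one]
  · rw [hf, map_mul, smul_mul', map_mul, hf, hf]
  · rw [hf, map_zero, smul_zero, map_zero]
  · rw [hf, map_add, smul_add, map_add, hf, hf]

/-- **The block homomorphism `σ ↦ res_E⁻¹(r⁻¹ res_L(σ) r)` is a restriction map along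
`i = λ⁻¹ ∘ r ∘ ε`, up to conjugacy.**  Let `E → L` be an `E`-algebra structure `i` on `L` with
`λ ∘ i = r ∘ ε` (`λ = absEmbedding K L`, `ε = absEmbedding K E`, `r ∈ Γ_K`).  Then for every
`σ ∈ Γ_L` the element `r⁻¹ · res_{L/K}(σ) · r` of `Γ_K` lies in `res_{E/K}(Γ_E)` and equals
`res_{E/K}(t · res_{L/E}(σ) · t⁻¹)` for one `t ∈ Γ_E` independent of `σ`: the map
`σ ↦ res_{E/K}⁻¹(r⁻¹ res_{L/K}(σ) r)` is compatible with the `E`-isomorphism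
`ι_L ∘ r ∘ ι_E⁻¹ : Ē ≅ L̄` (`ι_E`, `ι_L` the chosen `K̄ ≅ Ē`, `K̄ ≅ L̄`), so it is a restriction map
`Γ_L → Γ_E`, and restriction maps are well defined up to an inner automorphism
(`absGaloisRestrict_isConj_of_algHom_holds`).
[cite: MilneFT2022, Ch. 7 (the absolute Galois group: restriction well defined up to conjugacy)] -/
theorem exists_conj_absGaloisRestrict_eq_of_absEmbedding_eq [Algebra E L] (r : absoluteGaloisGroup K)
    (hr : ∀ x : E, absEmbedding K L (algebraMap E L x) = r • absEmbedding K E x) :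
    ∃ t : absoluteGaloisGroup E, ∀ σ : absoluteGaloisGroup L,
      r⁻¹ * absGaloisRestrict K L σ * r =
        absGaloisRestrict K E (t * absGaloisRestrict E L σ * t⁻¹) := by
  -- `r⁻¹ res_L(σ) r` fixes `ε(E)`, hence comes from `Γ_E`
  have hmem : ∀ σ : absoluteGaloisGroup L,
      r⁻¹ * absGaloisRestrict K L σ * r ∈ (absGaloisRestrict K E).range := fun σ => by
    rw [mem_range_absGaloisRestrict_iff_smul_absEmbedding]
    intro x
    rw [mul_smul, mul_smul, ← hr, absGaloisRestrict_smul_absEmbedding, hr, inv_smul_smul]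
  choose r' hr'₀ using hmem
  have hr' : ∀ σ, absGaloisRestrict K E (r' σ) = r⁻¹ * absGaloisRestrict K L σ * r := hr'₀
  -- the `E`-isomorphism `j = ι_L ∘ r ∘ ι_E⁻¹ : Ē ≅ L̄`
  let j₀ : AlgebraicClosure E ≃ₐ[K] AlgebraicClosure L :=
    ((absClosureEquiv K E).symm.trans (absoluteGaloisGroup.toAlgEquiv K r)).trans (absClosureEquiv K L)
  have hj₀ : ∀ y : AlgebraicClosure E,
      j₀ y = absClosureEmbedding K L (r • (absClosureEquiv K E).symm y) := fun y => rfl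
  have hιE : ∀ (τ : absoluteGaloisGroup E) (y : AlgebraicClosure E),
      (absClosureEquiv K E).symm (τ • y) = absGaloisRestrict K E τ • (absClosureEquiv K E).symm y :=
    fun τ y => by
    apply (absClosureEquiv K E).injective
    rw [AlgEquiv.apply_symm_apply, absClosureEquiv_apply, absGaloisRestrict_apply_smul,
      absClosureEmbedding_absClosureEquiv_symm]
  have hjE : ∀ x : E, j₀ (algebraMap E (AlgebraicClosure E) x) = algebraMap E (AlgebraicClosure L) x :=
    fun x => by
    rw [hj₀, IsScalarTower.algebraMap_apply E L (AlgebraicClosure L),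
      ← absClosureEmbedding_absEmbedding K L, hr]
    rfl
  let j : AlgebraicClosure E →ₐ[E] AlgebraicClosure L :=
    { (j₀ : AlgebraicClosure E →+* AlgebraicClosure L) with commutes' := hjE }
  have hj : ∀ y, j y = j₀ y := fun _ => rfl
  -- compatibility of `r'` with `j`
  have hcompat : ∀ (σ : absoluteGaloisGroup L) (y : AlgebraicClosure E), j (r' σ • y) = σ • j y := by
    intro σ y
    have hgrp : r * (r⁻¹ * absGaloisRestrict K L σ * r) = absGaloisRestrict K L σ * r := by group
    rw [hj, hj, hj₀, hj₀, hιE, hr', ← mul_smul, hgrp, mul_smul, absGaloisRestrict_apply_smul]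
  obtain ⟨t, ht⟩ := absGaloisRestrict_isConj_of_algHom_holds E L j r' hcompat
  exact ⟨t, fun σ => by rw [← hr' σ, ht σ]⟩

end Embeddings

section Blocks

variable {K E L : Type} [Field K] [NumberField K] [Field E] [NumberField E] [Field L] [NumberField L]
  [Algebra K E] [Algebra K L] {ℓ : ℕ} [Fact ℓ.Prime] {n : ℕ}

/-- **The block of `(Ind_E^K W)|_{Γ_L}` at the coset `r res(Γ_E)` is de Rham at every `u ∣ ℓ`.**
For number fields `K ⊆ E`, `K ⊆ L` with `r ε(E) ⊆ λ(L)` (`r ∈ Γ_K`; e.g. `L/K` Galois containing a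
conjugate of `E`) and a framed `W : Γ_E → GL_n(ℚ̄_ℓ)` de Rham at every `w ∣ ℓ` of `E` for the pinned
data, there is a framed `V : Γ_L → GL_n(ℚ̄_ℓ)` — namely `W(t) (W|_{Γ_L, i}) W(t)⁻¹` for the embedding
`i : E → L` of `exists_ringHom_absEmbedding_eq` and the `t` of
`exists_conj_absGaloisRestrict_eq_of_absEmbedding_eq` — such that `r⁻¹ res_L(σ) r = res_E(τ)` with
`V(σ) = W(τ)` for every `σ ∈ Γ_L`, and `V` is de Rham at every place `u ∣ ℓ` of `L` for the pinned
data (upward half of Brinon–Conrad Prop. 6.3.8, `isDeRhamFramed_toLocal_restrictField` with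
`DeRhamBaseChange_holds`, and frame invariance `IsDeRhamFramed.conj_frame`).
[cite: BrinonConrad2009, Prop. 6.3.8] [cite: MilneFT2022, Ch. 7] -/
theorem exists_block_isDeRhamFramed (r : absoluteGaloisGroup K)
    (hr : ∀ x : E, ∃ y : L, absEmbedding K L y = r • absEmbedding K E x)
    (W : FramedGaloisRep E (PadicAlgCl ℓ) n)
    (hW : ∀ (w : HeightOneSpectrum (𝓞 E)) (hw : ((ℓ : ℕ) : 𝓞 E) ∈ w.asIdeal),
      (fontainePstAdicCompletion w ℓ hw).IsDeRhamFramed (W.toLocal w)) :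
    ∃ V : FramedGaloisRep L (PadicAlgCl ℓ) n,
      (∀ σ : absoluteGaloisGroup L, ∃ τ : absoluteGaloisGroup E,
        r⁻¹ * absGaloisRestrict K L σ * r = absGaloisRestrict K E τ ∧ V σ = W τ) ∧
      ∀ (u : HeightOneSpectrum (𝓞 L)) (hu : ((ℓ : ℕ) : 𝓞 L) ∈ u.asIdeal),
        (fontainePstAdicCompletion u ℓ hu).IsDeRhamFramed (V.toLocal u) := by
  obtain ⟨i, hi⟩ := exists_ringHom_absEmbedding_eq r hr
  letI : Algebra E L := i.toAlgebra
  obtain ⟨t, ht⟩ := exists_conj_absGaloisRestrict_eq_of_absEmbedding_eq (K := K) (E := E) (L := L) r hi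
  refine ⟨FramedRep.conj (W t) (W.restrictField L), fun σ =>
    ⟨t * absGaloisRestrict E L σ * t⁻¹, ht σ, ?_⟩, fun u hu => ?_⟩
  · rw [FramedRep.conj_apply, FramedGaloisRep.restrictField_apply, map_mul, map_mul, map_inv]
  · change (fontainePstAdicCompletion u ℓ hu).IsDeRhamFramed
      ((FramedRep.conj (W t) (W.restrictField L)).comp (absGaloisRestrict L (u.adicCompletion L)))
    rw [FramedRep.conj_comp]
    exact (isDeRhamFramed_toLocal_restrictField
      Literature.NumberTheory.PAdicHodge.DeRhamBaseChange_holds W hW u hu).conj_frame (W t)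

end Blocks

end Literature.NumberTheory.GaloisRepresentations

/-! ### §3 The discharge -/

namespace Literature.NumberTheory.PAdicHodge

open Literature.NumberTheory.GaloisRepresentations

/-- **Discharge of `IsDeRhamFramedInduceSchema`** (Patrikis 2019, Lemma 7.2.1, for the pinned
Fontaine data): if `W : Γ_E → GL_n(ℚ̄_ℓ)` is de Rham at every `w ∣ ℓ` of `E` then `Ind_{Γ_E}^{Γ_K} W`
is de Rham at every `v ∣ ℓ` of `K`.  Proof: let `L = normalClosure K E K̄` (Galois over `K`, a
number field); `(Ind W)|_{Γ_L}` is block diagonal with blocks the framed representations of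
`exists_block_isDeRhamFramed` at the coset representatives `rᵢ` of `induce`
(`induce_apply_coe_of_forall_conj_mem`), each de Rham at every `u ∣ ℓ` of `L`; so `(Ind W)|_{Γ_L}` is
de Rham at every `u ∣ ℓ` (`PstWeilDeligneData.isDeRhamFramed_of_blockDiagonal`, Fontaine Prop. 1.5.2)
and `Ind W` is de Rham at every `v ∣ ℓ` by descent along `L/K` (`DeRhamRestrictFieldDescent_holds`,
Brinon–Conrad Prop. 6.3.8).
[cite: Patrikis2019, Lemma 7.2.1 (§7.2; arXiv:1207.6724 p. 38) and p. 64]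
[cite: BrinonConrad2009, Thm. 5.2.1 and Prop. 6.3.8] [cite: FontaineAsterisque223III, Prop. 1.5.2] -/
theorem IsDeRhamFramedInduceSchema_holds : IsDeRhamFramedInduceSchema := by
  intro K E _ _ _ _ _ d hd ℓ _ n W hW v hv
  classical
  -- the Galois closure of `E/K` inside `K̄`
  let Lf : IntermediateField K (AlgebraicClosure K) :=
    IntermediateField.normalClosure K E (AlgebraicClosure K)
  haveI : NumberField Lf := NumberField.of_module_finite K Lf
  -- every conjugate of `ε(E)` lies in `λ(L) = L`
  have hcl : ∀ (r : absoluteGaloisGroup K) (x : E),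
      ∃ y : Lf, absEmbedding K Lf y = r • absEmbedding K E x := by
    intro r x
    have hx : absEmbedding K E x ∈ Lf := (absEmbedding K E).fieldRange_le_normalClosure ⟨x, rfl⟩
    have hrx : r • absEmbedding K E x ∈ Lf := by
      refine (IntermediateField.normal_iff_forall_map_le'.1 (normalClosure.normal K E _)
        (absoluteGaloisGroup.toAlgEquiv K r)) ?_
      exact (IntermediateField.mem_map _).2 ⟨_, hx, rfl⟩
    rw [← AlgHom.fieldRange_of_normal (absEmbedding K Lf)] at hrx
    exact AlgHom.mem_fieldRange.1 hrx
  refine DeRhamRestrictFieldDescent_holds K Lf ℓ (d * n) (W.induce K hd) (fun u hu => ?_) v hv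
  -- the blocks of `(Ind W)|_{Γ_L}`
  choose V hV hVdR using fun i : Fin d =>
    exists_block_isDeRhamFramed (L := Lf) (absGaloisCosetRep K E hd i) (hcl _) W hW
  refine (fontainePstAdicCompletion u ℓ hu).isDeRhamFramed_of_blockDiagonal finProdFinEquiv
    (T := ((W.induce K hd).restrictField Lf).toLocal u) (B := fun i => (V i).toLocal u)
    (fun g => ?_) (fun i => hVdR i u hu)
  set σ := absGaloisRestrict Lf (u.adicCompletion Lf) g with hσ
  have hmem : ∀ i : Fin d, (absGaloisCosetRep K E hd i)⁻¹ * absGaloisRestrict K Lf σ *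
      absGaloisCosetRep K E hd i ∈ (absGaloisRestrict K E).range := fun i => by
    obtain ⟨τ, hτ, -⟩ := hV i σ
    exact ⟨τ, hτ.symm⟩
  have hblocks : (fun i : Fin d => dotExtend (absGaloisRestrict K E).toMonoidHom (FramedRep.toMatrixHom W)
      ((absGaloisCosetRep K E hd i)⁻¹ * absGaloisRestrict K Lf σ * absGaloisCosetRep K E hd i)) =
      fun i => (((V i).toLocal u g : GL (Fin n) (PadicAlgCl ℓ)) :
        Matrix (Fin n) (Fin n) (PadicAlgCl ℓ)) := by
    funext i
    obtain ⟨τ, hτ, hVτ⟩ := hV i σ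
    rw [FramedGaloisRep.dotExtend_eq_of_eq_absGaloisRestrict K W hτ, FramedGaloisRep.toLocal_apply,
      ← hσ, hVτ]
  rw [FramedGaloisRep.toLocal_apply, ← hσ, FramedGaloisRep.restrictField_apply,
    FramedGaloisRep.induce_apply_coe_of_forall_conj_mem K hd W _ hmem, hblocks]

end Literature.NumberTheory.PAdicHodge

end
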